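import Literature.Probability.Percolation.Z2HalfPlaneThreeArm
import Literature.Probability.Percolation.FiniteEnergy
import HarnessLib

/-!
# The fully docked two-arm event without the leg, and its window bound

Support file for the registered stub `stub_noTouch_undockedThreeArm` of crux
stmt-CriticalPhenomena-10268 (line `hitting-tournament`).  The two one-sided explorations proving
the undocked half-plane two-arm bound for critical bond percolation on `ℤ²` end on the FULLY DOCKED
event: an open lattice walk of the half-plane `{rows ≥ 0}` issued from a boundary site `(a, 0)` and
a dual walk issued from a moat face `(b, -1)` (never stepping along the moat), both reaching
sup-distance `L` from their docking points and drawn inside the box of size `Lb` around the window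
`[j, j + m) ∋ a, b`.  This is the tree's `Z2HalfPlane.twoArm j m L` (Lawler–Schramm–Werner's
Lemma A.1 in window form; `Z2HalfPlane.real_twoArm_le`: `P ≤ C m / n` for `m ≤ n`, `K n ≤ L`)
EXCEPT for the open leg `{(a,-1), (a,0)}` demanded there under the open docking.  The docked event
being determined by the edges of the half-plane (no leg), the leg under the least open docking
abscissa is inserted at the cost of a factor `2` (`bondPercolation_real_inter_memDep_ge`):

* `stub_undockedThreeArm_docked_le` — **`P(docked event; window [j, j+m), reach L) ≤ C' m / L`**
  for `1 ≤ m`, `K' m ≤ L`.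

References: G. F. Lawler, O. Schramm, W. Werner, Electron. J. Probab. 7 (2002), Appendix A,
Lemma A.1 [LawlerSchrammWernerEJP2002]; W. Werner, PCMI Lecture 2 (2009), first exercise sheet
[WernerPCMI2009]; G. Grimmett, *Percolation* (1999), §7.3 p. 167 (conditional independence of
unexamined edges) [GrimmettPercolation1999].
-/

noncomputable section

open Set MeasureTheory SimpleGraph
open Literature.Probability.Percolation Literature.Probability.LatticeModels
open Literature.Probability.Percolation.Z2HalfPlane

namespace Summit.CriticalPhenomena.CardyFormulaZ2.Cruxes.LagHandOff.HittingTournament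

/-! ### The docked arms are arms of the window -/

/-- A lattice neighbour outside the site box of a site inside it, both in the half-plane, is far.
[folklore] -/
theorem far_of_adj_not_mem_siteBox {a : ℤ} {L : ℕ} {x z : Site 2} (hxz : (zdGraph 2).Adj x z)
    (hx : x ∈ siteBox a L) (hz : z ∉ siteBox a L) (hz1 : 0 ≤ z 1) : Far L a x := by
  rw [mem_siteBox] at hx hz
  unfold Far
  rcases stepKind_of_adj hxz with ⟨h0, h1⟩ | ⟨h0, h1⟩ | ⟨h1, h0⟩ | ⟨h1, h0⟩ <;>
    · rcases le_or_gt a (x 0) with h | h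
      · rw [abs_of_nonneg (by omega)]; omega
      · rw [abs_of_neg (by omega)]; omega

/-- The same for faces and the face box. [folklore] -/
theorem far_of_adj_not_mem_faceBox {b : ℤ} {L : ℕ} {x z : Site 2} (hxz : (zdGraph 2).Adj x z)
    (hx : x ∈ faceBox b L) (hz : z ∉ faceBox b L) (hz1 : -1 ≤ z 1) : Far L b x := by
  rw [mem_faceBox] at hx hz
  unfold Far
  rcases stepKind_of_adj hxz with ⟨h0, h1⟩ | ⟨h0, h1⟩ | ⟨h1, h0⟩ | ⟨h1, h0⟩ <;>
    · rcases le_or_gt b (x 0) with h | h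
      · rw [abs_of_nonneg (by omega)]; omega
      · rw [abs_of_neg (by omega)]; omega

/-- **An open walk of the half-plane from `(a, 0)` reaching sup-distance `L` gives the open arm
of `twoArm`** (stop at the first exit from `siteBox a L`). [cite: LawlerSchrammWernerEJP2002, Appendix A] -/
theorem openArm_of_walk {ω : BondConfig (Site 2)} {a : ℤ} {L : ℕ} {v : Site 2}
    (P : (zdGraph 2).Walk (![a, 0] : Site 2) v) (hrow : ∀ z ∈ P.support, 0 ≤ z 1)
    (hP : ∀ e ∈ P.edges, e ∈ ω) (hv : Far L a v) :
    ∃ v' : Site 2, Far L a v' ∧ ω ∈ openConnIn ↑(siteBox a L) ![a, 0] v' := by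
  by_cases hin : ∀ z ∈ P.support, z ∈ siteBox a L
  · exact ⟨v, hv, mem_openConnIn_of_walk P (fun z hz => Finset.mem_coe.2 (hin z hz)) hP⟩
  · push Not at hin
    obtain ⟨z₀, hz₀, hz₀box⟩ := hin
    have hstart : (![a, 0] : Site 2) ∈ (↑(siteBox a L) : Set (Site 2)) := by
      rw [Finset.mem_coe, mem_siteBox]; simp
    obtain ⟨x, z, q₁, hxz, hz, hqA, hsupp, hedges, hxzP⟩ :=
      exists_prefix_exit (A := (↑(siteBox a L) : Set (Site 2))) (P.takeUntil z₀ hz₀) hstart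
        (fun h => hz₀box (Finset.mem_coe.1 h))
    have hzP : z ∈ P.support :=
      P.support_takeUntil_subset_support hz₀ ((P.takeUntil z₀ hz₀).snd_mem_support_of_mem_edges hxzP)
    refine ⟨x, far_of_adj_not_mem_siteBox hxz (Finset.mem_coe.1 (hqA x q₁.end_mem_support))
      (fun h => hz (Finset.mem_coe.2 h)) (hrow z hzP), mem_openConnIn_of_walk q₁ hqA fun e he => ?_⟩
    exact hP e (P.edges_takeUntil_subset_edges hz₀ (hedges e he))

/-- **A dual walk of half-plane faces from the moat face `(b, -1)` crossing closed edges and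
reaching sup-distance `L` gives the closed arm of `twoArm`.** [cite: LawlerSchrammWernerEJP2002, Appendix A] -/
theorem dualArm_of_walk {ω : BondConfig (Site 2)} {b : ℤ} {L : ℕ} {g : Site 2}
    (Q : (zdGraph 2).Walk (![b, -1] : Site 2) g) (hrow : ∀ z ∈ Q.support, -1 ≤ z 1)
    (hQ : ∀ d ∈ Q.darts, sepEdge d.fst d.snd ∉ ω) (hg : Far L b g) :
    ∃ g' : Site 2, Far L b g' ∧ dualConfig ω ∈ openConnIn ↑(faceBox b L) ![b, -1] g' := by
  -- the closed-edge condition along sub-walks given by their edges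
  have hclosed : ∀ {x y : Site 2} (q : (zdGraph 2).Walk x y), (∀ e ∈ q.edges, e ∈ Q.edges) →
      ∀ d ∈ q.darts, sepEdge d.fst d.snd ∉ ω := by
    intro x y q hq d hd
    have he : d.edge ∈ Q.edges := hq _ (List.mem_map.2 ⟨d, hd, rfl⟩)
    rw [Walk.edges, List.mem_map] at he
    obtain ⟨d', hd', hdd'⟩ := he
    rcases (SimpleGraph.dart_edge_eq_iff d' d).1 hdd' with h | h
    · rw [← h]; exact hQ d' hd'
    · have : sepEdge d.fst d.snd = sepEdge d'.fst d'.snd := by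
        rw [h]; exact sepEdge_comm _ _
      rw [this]; exact hQ d' hd'
  by_cases hin : ∀ z ∈ Q.support, z ∈ faceBox b L
  · exact ⟨g, hg, dualConfig_mem_openConnIn_of_walk Q (fun z hz => Finset.mem_coe.2 (hin z hz)) hQ⟩
  · push Not at hin
    obtain ⟨z₀, hz₀, hz₀box⟩ := hin
    have hstart : (![b, -1] : Site 2) ∈ (↑(faceBox b L) : Set (Site 2)) := by
      rw [Finset.mem_coe, mem_faceBox]; simp
    obtain ⟨x, z, q₁, hxz, hz, hqA, hsupp, hedges, hxzP⟩ :=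
      exists_prefix_exit (A := (↑(faceBox b L) : Set (Site 2))) (Q.takeUntil z₀ hz₀) hstart
        (fun h => hz₀box (Finset.mem_coe.1 h))
    have hzQ : z ∈ Q.support :=
      Q.support_takeUntil_subset_support hz₀ ((Q.takeUntil z₀ hz₀).snd_mem_support_of_mem_edges hxzP)
    refine ⟨x, far_of_adj_not_mem_faceBox hxz (Finset.mem_coe.1 (hqA x q₁.end_mem_support))
      (fun h => hz (Finset.mem_coe.2 h)) (hrow z hzQ),
      dualConfig_mem_openConnIn_of_walk q₁ hqA (hclosed q₁ fun e he => ?_)⟩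
    exact Q.edges_takeUntil_subset_edges hz₀ (hedges e he)

/-! ### The docked event is determined by the edges of the half-plane -/

/-- The edges crossed by a dual walk of faces of rows `≥ -1` never stepping along the moat have
both ends in the half-plane `{rows ≥ 0}`. [folklore] -/
theorem sepEdge_rows_nonneg {f g : Site 2} (h : (zdGraph 2).Adj f g) (hf : -1 ≤ f 1) (hg : -1 ≤ g 1)
    (hmoat : f 1 = -1 → g 1 ≠ -1) : ∀ x ∈ sepEdge f g, 0 ≤ x 1 := by
  rcases stepKind_of_adj h with ⟨h0, h1⟩ | ⟨h0, h1⟩ | ⟨h1, h0⟩ | ⟨h1, h0⟩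
  · obtain rfl : g = f + Pi.single 0 1 := by rw [Site.eq_iff_two]; simp [h0, h1]
    have hf0 : 0 ≤ f 1 := by
      by_contra hneg
      exact hmoat (by omega) (by simp; omega)
    intro x hx
    rw [sepEdge_right, Sym2.mem_iff] at hx
    rcases hx with rfl | rfl <;> simp <;> omega
  · obtain rfl : f = g + Pi.single 0 1 := by rw [Site.eq_iff_two]; simp [h0, h1]
    have hg0 : 0 ≤ g 1 := by
      by_contra hneg
      exact hmoat (by simp; omega) (by omega)
    intro x hx
    rw [sepEdge_comm, sepEdge_right, Sym2.mem_iff] at hx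
    rcases hx with rfl | rfl <;> simp <;> omega
  · obtain rfl : g = f + Pi.single 1 1 := by rw [Site.eq_iff_two]; simp [h0, h1]
    intro x hx
    rw [sepEdge_up, Sym2.mem_iff] at hx
    rcases hx with rfl | rfl <;> simp <;> omega
  · obtain rfl : f = g + Pi.single 1 1 := by rw [Site.eq_iff_two]; simp [h0, h1]
    intro x hx
    rw [sepEdge_comm, sepEdge_up, Sym2.mem_iff] at hx
    rcases hx with rfl | rfl <;> simp <;> omega

/-- The leg is not an edge of the half-plane. [folklore] -/
theorem leg_not_rows_nonneg (a : ℤ) : ¬ ∀ x ∈ leg a, 0 ≤ x 1 := by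
  intro h
  have := h ![a, -1] (by rw [leg]; exact Sym2.mem_mk_left _ _)
  simp at this

/-! ### The window bound for the docked event -/

/-- **Window bound for the fully docked event without the leg.**  For the event that some open
walk of the half-plane from a window site `(a, 0)` and some dual walk of faces of rows `≥ -1`
(never along the moat, crossing closed edges) from a window moat face `(b, -1)`, both inside the
box of size `Lb` around the window `[j, j + m)`, reach sup-distance `L`:
`P ≤ C m / L` whenever `1 ≤ m`, `K m ≤ L ≤ Lb` (insert the leg under the least open docking
abscissa by independence, then Lawler–Schramm–Werner's window bound `Z2HalfPlane.real_twoArm_le`).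
[cite: LawlerSchrammWernerEJP2002, Appendix A, Lemma A.1] -/
theorem stub_undockedThreeArm_docked_le : ∃ C K : ℝ, 0 < C ∧ 1 ≤ K ∧ ∀ (j : ℤ) (m L Lb : ℕ), 1 ≤ m → K * m ≤ L → L ≤ Lb → (bondPercolation (zdGraph 2) half).real {ω | ∃ a b : ℤ, (j ≤ a ∧ a < j + m ∧ j ≤ b ∧ b < j + m) ∧ (∃ (v : Site 2) (P : (zdGraph 2).Walk (![a, 0] : Site 2) v), Far L a v ∧ (∀ z ∈ P.support, z ∈ siteBox j Lb) ∧ ∀ e ∈ P.edges, e ∈ ω) ∧ ∃ (g : Site 2) (Q : (zdGraph 2).Walk (![b, -1] : Site 2) g), Far L b g ∧ (∀ z ∈ Q.support, z ∈ faceBox j Lb) ∧ (∀ d ∈ Q.darts, d.fst 1 = -1 → d.snd 1 ≠ -1) ∧ ∀ d ∈ Q.darts, sepEdge d.fst d.snd ∉ ω} ≤ C * m / L := by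
  classical
  obtain ⟨C, hC, K, hK, hW⟩ := real_twoArm_le
  refine ⟨4 * C * K, 2 * K, by positivity, by
    have : (1 : ℝ) ≤ K := by exact_mod_cast hK
    linarith, fun j m L Lb hm hKL hLb => ?_⟩
  set μ := bondPercolation (zdGraph 2) half with hμ
  -- the arms, as predicates of the configuration
  set OpenArm : ℤ → BondConfig (Site 2) → Prop := fun a ω => ∃ (v : Site 2) (P : (zdGraph 2).Walk (![a, 0] : Site 2) v),
    Far L a v ∧ (∀ z ∈ P.support, z ∈ siteBox j Lb) ∧ ∀ e ∈ P.edges, e ∈ ω with hOpenArm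
  set ClosedArm : ℤ → BondConfig (Site 2) → Prop := fun b ω => ∃ (g : Site 2) (Q : (zdGraph 2).Walk (![b, -1] : Site 2) g),
    Far L b g ∧ (∀ z ∈ Q.support, z ∈ faceBox j Lb) ∧ (∀ d ∈ Q.darts, d.fst 1 = -1 → d.snd 1 ≠ -1) ∧
      ∀ d ∈ Q.darts, sepEdge d.fst d.snd ∉ ω with hClosedArm
  set A : Set (BondConfig (Site 2)) := {ω | ∃ a b : ℤ, (j ≤ a ∧ a < j + m ∧ j ≤ b ∧ b < j + m) ∧
    OpenArm a ω ∧ ClosedArm b ω} with hA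
  show μ.real A ≤ 4 * C * K * m / L
  -- the half-plane edges of the box: a finite determining set avoiding every leg
  set NL : Set (Sym2 (Site 2)) := {e | ∀ x ∈ e, 0 ≤ x 1} with hNL
  set Fbox : Finset (Sym2 (Site 2)) := (faceBox j (Lb + 1)).sym2 with hFbox
  have hsite_face : ∀ z ∈ siteBox j Lb, z ∈ faceBox j (Lb + 1) := fun z hz => by
    rw [mem_siteBox] at hz; rw [mem_faceBox]; push_cast; omega
  have hsep_face : ∀ {f g : Site 2}, (zdGraph 2).Adj f g → f ∈ faceBox j Lb → ∀ x ∈ sepEdge f g, x ∈ faceBox j (Lb + 1) := by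
    intro f g h hf x hx
    rw [mem_faceBox] at hf
    rw [mem_faceBox]; push_cast
    rcases stepKind_of_adj h with ⟨h0, h1⟩ | ⟨h0, h1⟩ | ⟨h1, h0⟩ | ⟨h1, h0⟩
    · obtain rfl : g = f + Pi.single 0 1 := by rw [Site.eq_iff_two]; simp [h0, h1]
      rw [sepEdge_right, Sym2.mem_iff] at hx
      rcases hx with rfl | rfl <;> simp <;> omega
    · obtain rfl : f = g + Pi.single 0 1 := by rw [Site.eq_iff_two]; simp [h0, h1]
      rw [sepEdge_comm, sepEdge_right, Sym2.mem_iff] at hx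
      simp only [Pi.add_apply, Pi.single_eq_same, ne_eq, one_ne_zero, not_false_eq_true,
        Pi.single_eq_of_ne, add_zero] at hf
      rcases hx with rfl | rfl <;> simp <;> omega
    · obtain rfl : g = f + Pi.single 1 1 := by rw [Site.eq_iff_two]; simp [h0, h1]
      rw [sepEdge_up, Sym2.mem_iff] at hx
      rcases hx with rfl | rfl <;> simp <;> omega
    · obtain rfl : f = g + Pi.single 1 1 := by rw [Site.eq_iff_two]; simp [h0, h1]
      rw [sepEdge_comm, sepEdge_up, Sym2.mem_iff] at hx
      simp only [Pi.add_apply, Pi.single_eq_same, ne_eq, zero_ne_one, not_false_eq_true,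
        Pi.single_eq_of_ne, add_zero] at hf
      rcases hx with rfl | rfl <;> simp <;> omega
  -- agreement on `NL ∩ Fbox` transports both arms
  have hOpen_congr : ∀ ω ω' : BondConfig (Site 2), ω ∩ (NL ∩ ↑Fbox) = ω' ∩ (NL ∩ ↑Fbox) →
      ∀ a, OpenArm a ω → OpenArm a ω' := by
    rintro ω ω' h a ⟨v, P, hfar, hbox, hP⟩
    refine ⟨v, P, hfar, hbox, fun e he => ?_⟩
    have heNL : e ∈ NL ∩ (↑Fbox : Set (Sym2 (Site 2))) := by
      have he' := he
      rw [Walk.edges, List.mem_map] at he'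
      obtain ⟨d, hd, rfl⟩ := he'
      have h1 := hbox _ (P.dart_fst_mem_support_of_mem_darts hd)
      have h2 := hbox _ (P.dart_snd_mem_support_of_mem_darts hd)
      refine ⟨?_, Finset.mem_coe.2 (Finset.mk_mem_sym2_iff.2 ⟨hsite_face _ h1, hsite_face _ h2⟩)⟩
      intro x hx
      rcases Sym2.mem_iff.1 hx with rfl | rfl
      · exact ((mem_siteBox.1 h1).2).1
      · exact ((mem_siteBox.1 h2).2).1
    exact ((Set.ext_iff.1 h e).1 ⟨hP e he, heNL⟩).1
  have hClosed_congr : ∀ ω ω' : BondConfig (Site 2), ω ∩ (NL ∩ ↑Fbox) = ω' ∩ (NL ∩ ↑Fbox) →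
      ∀ b, ClosedArm b ω → ClosedArm b ω' := by
    rintro ω ω' h b ⟨g, Q, hfar, hbox, hmoat, hQ⟩
    refine ⟨g, Q, hfar, hbox, hmoat, fun d hd hd' => hQ d hd ?_⟩
    have heNL : sepEdge d.fst d.snd ∈ NL ∩ (↑Fbox : Set (Sym2 (Site 2))) := by
      have h1 := hbox _ (Q.dart_fst_mem_support_of_mem_darts hd)
      have h2 := hbox _ (Q.dart_snd_mem_support_of_mem_darts hd)
      refine ⟨sepEdge_rows_nonneg d.adj ((mem_faceBox.1 h1).2).1 ((mem_faceBox.1 h2).2).1 (hmoat d hd), ?_⟩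
      have hmem := hsep_face d.adj h1
      refine Finset.mem_coe.2 ?_
      induction hsd : sepEdge d.fst d.snd using Sym2.ind with
      | h x y =>
        rw [hsd] at hmem
        exact Finset.mk_mem_sym2_iff.2 ⟨hmem x (Sym2.mem_mk_left _ _), hmem y (Sym2.mem_mk_right _ _)⟩
    exact ((Set.ext_iff.1 h _).2 ⟨hd', heNL⟩).1
  -- the least open docking abscissa, as a statistic factoring through the arm predicates
  set Gsel : (ℤ → Prop) → ℤ := fun Pr =>
    if h : ∃ a, (j ≤ a ∧ a < j + m) ∧ Pr a then
      Classical.choose (Int.exists_least_of_bdd ⟨j, fun z hz => hz.1.1⟩ h) else j with hGsel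
  have hGsel_spec : ∀ Pr : ℤ → Prop, (∃ a, (j ≤ a ∧ a < j + m) ∧ Pr a) →
      ((j ≤ Gsel Pr ∧ Gsel Pr < j + m) ∧ Pr (Gsel Pr)) := by
    intro Pr h
    simp only [hGsel, dif_pos h]
    exact (Classical.choose_spec (Int.exists_least_of_bdd ⟨j, fun z hz => hz.1.1⟩ h)).1
  set Ψ : BondConfig (Site 2) → ℤ := fun ω => Gsel fun a => OpenArm a ω with hΨ
  have hΨ_congr : ∀ ω ω' : BondConfig (Site 2), ω ∩ (NL ∩ ↑Fbox) = ω' ∩ (NL ∩ ↑Fbox) → Ψ ω = Ψ ω' := by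
    intro ω ω' h
    simp only [hΨ]
    congr 1
    funext a
    exact propext ⟨hOpen_congr ω ω' h a, hOpen_congr ω' ω h.symm a⟩
  -- determinacy and measurability of the pieces
  have hdet : ∀ a₀ : ℤ, DeterminedBy (A ∩ Ψ ⁻¹' {a₀}) (NL ∩ ↑Fbox) := by
    intro a₀
    rw [determinedBy_iff]
    intro ω ω' h
    simp only [mem_inter_iff, mem_preimage, mem_singleton_iff, hA, mem_setOf_eq]
    rw [hΨ_congr ω ω' h]
    refine and_congr_left fun _ => ⟨?_, ?_⟩
    · rintro ⟨a, b, hab, ho, hc⟩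
      exact ⟨a, b, hab, hOpen_congr ω ω' h a ho, hClosed_congr ω ω' h b hc⟩
    · rintro ⟨a, b, hab, ho, hc⟩
      exact ⟨a, b, hab, hOpen_congr ω' ω h.symm a ho, hClosed_congr ω' ω h.symm b hc⟩
  have hmeas : ∀ a₀ : ℤ, MeasurableSet (A ∩ Ψ ⁻¹' {a₀}) := fun a₀ =>
    ((hdet a₀).mono (fun e he => he.2)).measurableSet_of_finset
  -- leg insertion: `P(A) / 2 ≤ P(A ∩ {leg (Ψ ω) open})`
  have hleg_half : ∀ a : ℤ, (1 / 2 : ℝ) ≤ μ.real {ω : BondConfig (Site 2) | leg a ∈ ω} := by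
    intro a
    have hadj : (zdGraph 2).Adj (![a, -1] : Site 2) ![a, 0] := by
      have h := adj_sub_single_one (![a, 0] : Site 2)
      have he : (![a, 0] : Site 2) - Pi.single 1 1 = ![a, -1] := by
        rw [Site.eq_iff_two]; simp
      rw [he] at h
      exact h.symm
    have : μ.real {ω : BondConfig (Site 2) | leg a ∈ ω} = half :=
      bondPercolation_cylinder (zdGraph 2) half ((SimpleGraph.mem_edgeSet _).2 hadj)
    rw [this]; exact le_of_eq rfl
  have hins : (1 / 2 : ℝ) * μ.real A ≤ μ.real (A ∩ {ω | ω ∈ {ω' : BondConfig (Site 2) | leg (Ψ ω) ∈ ω'}}) := by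
    refine bondPercolation_real_inter_memDep_ge (zdGraph 2) half (fun _ => NL ∩ ↑Fbox) (fun a => {leg a}) Ψ
      (fun a => {ω' : BondConfig (Site 2) | leg a ∈ ω'}) hdet hmeas
      (fun a => (determinedBy_iff _ _).2 fun ω ω' h => by
        simp only [mem_setOf_eq]
        exact ⟨fun h1 => ((Set.ext_iff.1 h _).1 ⟨h1, rfl⟩).1, fun h1 => ((Set.ext_iff.1 h _).2 ⟨h1, rfl⟩).1⟩)
      (fun a => measurableSet_mem _)
      (fun ω _ => Set.disjoint_left.2 ?_) (by norm_num) (fun ω _ => hleg_half (Ψ ω))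
    rintro e ⟨he, -⟩ rfl
    exact leg_not_rows_nonneg _ he
  -- the docked event with the leg is the window two-arm event
  have hsub : A ∩ {ω | ω ∈ {ω' : BondConfig (Site 2) | leg (Ψ ω) ∈ ω'}} ⊆ twoArm j m L := by
    rintro ω ⟨⟨a, b, ⟨hja, ham, hjb, hbm⟩, ho, hc⟩, hleg⟩
    have hex : ∃ a, (j ≤ a ∧ a < j + m) ∧ OpenArm a ω := ⟨a, ⟨hja, ham⟩, ho⟩
    obtain ⟨⟨hjΨ, hΨm⟩, v, P, hfar, hbox, hP⟩ := hGsel_spec _ hex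
    obtain ⟨g, Q, hgfar, hgbox, hmoat, hQ⟩ := hc
    obtain ⟨v', hv', hopen⟩ := openArm_of_walk P (fun z hz => ((mem_siteBox.1 (hbox z hz)).2).1) hP hfar
    obtain ⟨g', hg', hdual⟩ := dualArm_of_walk Q (fun z hz => ((mem_faceBox.1 (hgbox z hz)).2).1) hQ hgfar
    exact ⟨Ψ ω, b, hjΨ, hΨm, hjb, hbm, hleg, ⟨v', hv', hopen⟩, g', hg', hdual⟩
  -- Werner's window bound at `n = L / K`
  have hK0 : 0 < K := hK
  have hm0 : (0 : ℝ) < m := by exact_mod_cast hm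
  have hL0 : (0 : ℝ) < L := by
    have : (1 : ℝ) ≤ K := by exact_mod_cast hK
    nlinarith
  set n := L / K with hn
  have hKn : K * n ≤ L := Nat.mul_div_le L K
  have hmn : m ≤ n := by
    rw [hn, Nat.le_div_iff_mul_le hK0]
    have : (2 * K : ℝ) * m ≤ L := hKL
    have : (m * K : ℝ) ≤ L := by nlinarith
    exact_mod_cast this
  have hn_ge : (L : ℝ) / (2 * K) ≤ n := by
    -- `n ≥ L / K - 1 ≥ L / (2K)` as `L ≥ 2K`
    have h1 : (L : ℝ) < (n + 1) * K := by exact_mod_cast Nat.lt_mul_of_div_lt (Nat.lt_succ_self _) hK0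
    have hK1 : (1 : ℝ) ≤ K := by exact_mod_cast hK
    have hm1 : (1 : ℝ) ≤ m := by exact_mod_cast hm
    have hL2K : (2 * K : ℝ) ≤ L := by nlinarith [hKL, hm1, hK1]
    rw [div_le_iff₀ (by positivity)]
    nlinarith
  have hn0 : (0 : ℝ) < n := lt_of_lt_of_le (by positivity) hn_ge
  have hwerner : μ.real (twoArm j m L) ≤ C * m / n := hW j m n L hm hmn hKn
  calc μ.real A ≤ 2 * μ.real (A ∩ {ω | ω ∈ {ω' : BondConfig (Site 2) | leg (Ψ ω) ∈ ω'}}) := by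
        linarith [hins]
    _ ≤ 2 * μ.real (twoArm j m L) :=
        mul_le_mul_of_nonneg_left (measureReal_mono hsub (measure_ne_top _ _)) (by norm_num)
    _ ≤ 2 * (C * m / n) := mul_le_mul_of_nonneg_left hwerner (by norm_num)
    _ ≤ 2 * (C * m / (L / (2 * K))) := by
        refine mul_le_mul_of_nonneg_left (div_le_div_of_nonneg_left (by positivity) (by positivity) hn_ge) (by norm_num)
    _ = 4 * C * K * m / L := by field_simp; ring

end Summit.CriticalPhenomena.CardyFormulaZ2.Cruxes.LagHandOff.HittingTournament
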